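import Literature.Algebra.EuclideanLattices.RegevQuantumApprox
import Literature.Algebra.EuclideanLattices.RegevQFTPeriodicGaussian
import HarnessLib

/-!
# Regev 2009, Lemma 3.14: the periodic Gaussian state in coordinates, and Claim 3.13 for it

Topic `Algebra/EuclideanLattices` (family `pqc`). Serves the decomposition of the named fact
`Literature.Computability.Cryptography.regev_lwe_to_sivp_quantum` (pqc.S19; Regev, J. ACM 56 (2009),
Thm 1.1): the quantum half of the iterative step, **Lemma 3.14**. There (author's version
arXiv:2401.03703, pp. 19–20) the register holds the coordinates `s ∈ ℤ_Rⁿ` of a point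
`x_s = ∑ sᵢeᵢ` of the lattice `Λ = L*/R` (basis `eᵢ = L*ᵢ/R`), a representative of `Λ` modulo its
sublattice `RΛ = L*`; the two states of Claim 3.13 are, in these coordinates,
`ϑ₂(s) = ∑_{z ∈ RΛ} ρ(x_s + z) = ρ(x_s + RΛ)` (eq. (12)) and its truncation
`ϑ₁(s) = ∑_{z ∈ RΛ, ‖x_s + z‖ < √n} ρ(x_s + z)`.

This file (theorems, plus definitions with bodies) sets up that dictionary and records Claim 3.13
in coordinates:

* `Regev2009.scaledLattice Λ R = RΛ` (a full-rank sublattice; `scaledEquiv : Λ ≃ RΛ`);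
* `Regev2009.reprPt Λ e R s = x_s`, injective in `s`, and `Regev2009.isTransversal_reprSet`: the
  points `x_s`, `s ∈ ℤ_Rⁿ`, form a transversal of `Λ/RΛ` (Euclidean division in coordinates);
* `Regev2009.periodicAmp_eq_toReal_gaussianMass` — `ϑ₂(s) = periodicAmp Λ e R s = ρ(x_s + RΛ)`
  (the amplitude of `RegevQFTPeriodicGaussian`), `Regev2009.truncAmp` (`ϑ₁`) and
  `fullAmp_eq_truncAmp_add_tailAmp` (`ϑ₂ = ϑ₁ + tail`);
* `Regev2009.claim_3_13_coords` — **`∑_s (ϑ₂(s) − ϑ₁(s))² ≤ 2^{-2n} ∑_s ϑ₂(s)²`**, i.e.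
  `‖ϑ₂ − ϑ₁‖ ≤ 2⁻ⁿ‖ϑ₂‖` for the coordinate vectors (Claim 3.13 with `T = Λ`, sublattice `RΛ`,
  transversal `{x_s}`).

## References

* O. Regev, *On lattices, learning with errors, random linear codes, and cryptography*, J. ACM 56
  (2009), art. 34; author's version arXiv:2401.03703, Claim 3.13, Lemma 3.14 and eq. (12)
  [Regev2009].
-/

noncomputable section

open Module Metric
open scoped ENNReal

namespace Literature.Algebra.EuclideanLattices

namespace Regev2009

variable {V : Type*} [NormedAddCommGroup V] [InnerProductSpace ℝ V]
variable {ι : Type*} [Fintype ι]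
variable (Λ : Submodule ℤ V) (e : Basis ι ℤ Λ)

/-! ### The sublattice `RΛ` -/

/-- **The sublattice `RΛ`** (Regev: `L* = R · (L*/R)`). [cite: Regev2009, Lemma 3.14] -/
def scaledLattice (R : ℕ) : Submodule ℤ V := Λ.map ((R : ℤ) • (LinearMap.id : V →ₗ[ℤ] V))

/-- Membership in `RΛ`. [folklore] -/
theorem mem_scaledLattice {R : ℕ} {z : V} : z ∈ scaledLattice Λ R ↔ ∃ y ∈ Λ, (R : ℝ) • y = z := by
  rw [scaledLattice, Submodule.mem_map]
  constructor
  · rintro ⟨y, hy, rfl⟩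
    refine ⟨y, hy, ?_⟩
    simp only [LinearMap.smul_apply, LinearMap.id_coe, id_eq, Nat.cast_smul_eq_nsmul]
  · rintro ⟨y, hy, rfl⟩
    refine ⟨y, hy, ?_⟩
    simp only [LinearMap.smul_apply, LinearMap.id_coe, id_eq, Nat.cast_smul_eq_nsmul]

/-- `R y ∈ RΛ` for `y ∈ Λ`. [folklore] -/
theorem smul_coe_mem_scaledLattice (R : ℕ) (y : Λ) : (R : ℝ) • (y : V) ∈ scaledLattice Λ R :=
  (mem_scaledLattice Λ).2 ⟨y, y.2, rfl⟩

/-- `RΛ ≤ Λ`. [folklore] -/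
theorem scaledLattice_le (R : ℕ) : scaledLattice Λ R ≤ Λ := by
  intro z hz
  obtain ⟨y, hy, rfl⟩ := (mem_scaledLattice Λ).1 hz
  have h := Λ.smul_mem (R : ℤ) hy
  rwa [natCast_zsmul, ← Nat.cast_smul_eq_nsmul ℝ] at h

/-- `RΛ` is discrete. [folklore] -/
instance instDiscreteTopologyScaledLattice (R : ℕ) [DiscreteTopology Λ] : DiscreteTopology (scaledLattice Λ R) :=
  DiscreteTopology.of_subset ‹_› (scaledLattice_le Λ R)

/-- `RΛ` is a full-rank lattice (`R ≥ 1`). [folklore] -/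
instance instIsZLatticeScaledLattice (R : ℕ) [NeZero R] [DiscreteTopology Λ] [IsZLattice ℝ Λ] :
    IsZLattice ℝ (scaledLattice Λ R) := by
  refine ⟨eq_top_iff.2 ?_⟩
  have hR : (R : ℝ) ≠ 0 := by exact_mod_cast NeZero.ne R
  have hΛ : (Λ : Set V) ⊆ Submodule.span ℝ (scaledLattice Λ R : Set V) := by
    intro y hy
    have h : (R : ℝ)⁻¹ • ((R : ℝ) • y) ∈ Submodule.span ℝ (scaledLattice Λ R : Set V) :=
      Submodule.smul_mem _ _ (Submodule.subset_span ((mem_scaledLattice Λ).2 ⟨y, hy, rfl⟩))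
    rwa [smul_smul, inv_mul_cancel₀ hR, one_smul] at h
  calc (⊤ : Submodule ℝ V) = Submodule.span ℝ (Λ : Set V) := IsZLattice.span_top.symm
    _ ≤ Submodule.span ℝ (scaledLattice Λ R : Set V) := Submodule.span_le.2 hΛ

/-- **`Λ ≃ RΛ`, `y ↦ R y`** (`R ≥ 1`). [folklore] -/
def scaledEquiv (R : ℕ) [NeZero R] : Λ ≃ scaledLattice Λ R :=
  Equiv.ofBijective (fun y => ⟨(R : ℝ) • (y : V), smul_coe_mem_scaledLattice Λ R y⟩) (by
    have hR : (R : ℝ) ≠ 0 := by exact_mod_cast NeZero.ne R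
    constructor
    · intro y y' h
      have h' : (R : ℝ) • (y : V) = (R : ℝ) • (y' : V) := congrArg Subtype.val h
      exact Subtype.ext (smul_right_injective V hR h')
    · rintro ⟨z, hz⟩
      obtain ⟨y, hy, rfl⟩ := (mem_scaledLattice Λ).1 hz
      exact ⟨⟨y, hy⟩, rfl⟩)

/-- Value of `scaledEquiv`. [folklore] -/
@[simp] theorem coe_scaledEquiv (R : ℕ) [NeZero R] (y : Λ) :
    ((scaledEquiv Λ R y : scaledLattice Λ R) : V) = (R : ℝ) • (y : V) := rfl

/-! ### The representatives `x_s` and the transversal -/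

/-- **The representative `x_s = ∑ᵢ sᵢ eᵢ`** of the register content `s ∈ ℤ_Rⁿ` (coordinates read in
`{0, …, R-1}`; Regev: the point of `L*/R ∩ P(L*)` with coordinates `s`). [cite: Regev2009, Lemma 3.14 (eq. (12))] -/
def reprPt (R : ℕ) (s : ι → ZMod R) : V := latticePt Λ e fun i => ((s i).val : ℤ)

omit [InnerProductSpace ℝ V] in
/-- `x_s ∈ Λ`. [folklore] -/
theorem reprPt_mem (R : ℕ) (s : ι → ZMod R) : reprPt Λ e R s ∈ Λ := by
  unfold reprPt latticePt
  exact Submodule.coe_mem _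

omit [InnerProductSpace ℝ V] in
/-- `latticePt` is injective (coordinates in a basis). [folklore] -/
theorem latticePt_injective : Function.Injective (latticePt Λ e) := by
  intro m m' h
  exact e.equivFun.symm.injective (Subtype.ext h)

omit [InnerProductSpace ℝ V] in
/-- **`s ↦ x_s` is injective.** [folklore] -/
theorem reprPt_injective (R : ℕ) [NeZero R] : Function.Injective (reprPt Λ e R) := by
  intro s s' h
  have h' := latticePt_injective Λ e h
  funext i
  have hi := congrFun h' i
  simp only [Nat.cast_inj] at hi
  exact ZMod.val_injective R hi

/-- `x_{val s + R r}`-decomposition: a lattice point with coordinates `m` is `x_{m mod R} + R · (∑ (m div R)ᵢ eᵢ)`.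
[folklore] -/
theorem latticePt_eq_reprPt_add (R : ℕ) [NeZero R] (m : ι → ℤ) :
    latticePt Λ e m = reprPt Λ e R ((euclidEquiv R).symm m).1 +
      (R : ℝ) • latticePt Λ e ((euclidEquiv R).symm m).2 := by
  conv_lhs => rw [← (euclidEquiv R).apply_symm_apply m]
  rw [reprPt, ← Int.cast_natCast, ← latticePt_add_smul]
  congr 1

/-! ### The amplitudes `ϑ₂`, `ϑ₁` in coordinates -/

omit [InnerProductSpace ℝ V] in
/-- The Gaussian mass with centre `-c` of a submodule equals that with centre `c` (symmetry
`z ↦ -z`). [folklore] -/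
theorem gaussianMass_neg_center (M : Submodule ℤ V) (s : ℝ) (c : V) :
    gaussianMass s (-c) (M : Set V) = gaussianMass s c (M : Set V) := by
  rw [gaussianMass_submodule, gaussianMass_submodule, ← (Equiv.neg M).tsum_eq]
  refine tsum_congr fun z => ?_
  simp only [Equiv.neg_apply, Submodule.coe_neg, sub_neg_eq_add]
  rw [← gaussianFunction_neg, neg_add, neg_neg, sub_eq_add_neg]

/-- **`ϑ₂(s) = ρ(x_s + RΛ)`**: the amplitude `periodicAmp Λ e R s = ∑_{y ∈ Λ} ρ(x_s + R y)` of
`RegevQFTPeriodicGaussian` is the Gaussian mass of the coset `x_s + RΛ`, i.e.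
`gaussianMass 1 (-x_s) (RΛ)`. [cite: Regev2009, Lemma 3.14 (eq. (12))] -/
theorem periodicAmp_eq_toReal_gaussianMass [FiniteDimensional ℝ V] [DiscreteTopology Λ] (R : ℕ) [NeZero R] (s : ι → ZMod R) :
    periodicAmp Λ e R s = (gaussianMass 1 (-reprPt Λ e R s) (scaledLattice Λ R : Set V)).toReal := by
  rw [gaussianMass_coe_eq_ofReal_tsum (scaledLattice Λ R) one_ne_zero,
    ENNReal.toReal_ofReal (tsum_nonneg fun _ => (gaussianFunction_pos _ _).le), periodicAmp,
    ← (scaledEquiv Λ R).tsum_eq]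
  refine tsum_congr fun y => ?_
  rw [coe_scaledEquiv, sub_neg_eq_add, add_comm]
  rfl

/-- **The truncated amplitude `ϑ₁(s) = ∑_{z ∈ RΛ, ‖x_s + z‖ < √n} ρ(x_s + z)`** (the points of the
coset `x_s + RΛ` of norm `< √n`). [cite: Regev2009, Claim 3.13 (`ϑ₁`), Lemma 3.14] -/
def truncAmp (R : ℕ) (s : ι → ZMod R) : ℝ :=
  (gaussianMass 1 (-reprPt Λ e R s) ((scaledLattice Λ R : Set V) ∩ ball (-reprPt Λ e R s) (Real.sqrt (finrank ℝ V)))).toReal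

/-- **The tail amplitude `(ϑ₂ - ϑ₁)(s)`** (the points of the coset of norm `≥ √n`). [cite: Regev2009, Claim 3.13] -/
def tailAmp (R : ℕ) (s : ι → ZMod R) : ℝ :=
  (gaussianMass 1 (-reprPt Λ e R s) ((scaledLattice Λ R : Set V) \ ball (-reprPt Λ e R s) (Real.sqrt (finrank ℝ V)))).toReal

omit [InnerProductSpace ℝ V] in
/-- Splitting a Gaussian mass along a set: `ρ(A) = ρ(A ∩ B) + ρ(A ∖ B)`. [folklore] -/
theorem gaussianMass_eq_inter_add_diff (s : ℝ) (c : V) (A B : Set V) :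
    gaussianMass s c A = gaussianMass s c (A ∩ B) + gaussianMass s c (A \ B) := by
  have hU : A ∩ B ∪ A \ B = A := Set.inter_union_sdiff A B
  rw [gaussianMass, gaussianMass, gaussianMass,
    ← tsum_congr_set_coe (fun x : V => ENNReal.ofReal (gaussianFunction s (x - c))) hU,
    ENNReal.summable.tsum_union_disjoint (f := fun x : V => ENNReal.ofReal (gaussianFunction s (x - c)))
      (Set.disjoint_sdiff_right.mono_left Set.inter_subset_right) ENNReal.summable]

/-- **`ϑ₂ = ϑ₁ + (ϑ₂ - ϑ₁)`** pointwise. [cite: Regev2009, Claim 3.13] -/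
theorem periodicAmp_eq_truncAmp_add_tailAmp [FiniteDimensional ℝ V] [DiscreteTopology Λ] (R : ℕ) [NeZero R] (s : ι → ZMod R) :
    periodicAmp Λ e R s = truncAmp Λ e R s + tailAmp Λ e R s := by
  have hfin : gaussianMass 1 (-reprPt Λ e R s) (scaledLattice Λ R : Set V) ≠ ⊤ :=
    gaussianMass_lattice_ne_top (scaledLattice Λ R) one_ne_zero _
  rw [periodicAmp_eq_toReal_gaussianMass, truncAmp, tailAmp, ← ENNReal.toReal_add, ← gaussianMass_eq_inter_add_diff]
  · exact ne_top_of_le_ne_top hfin (gaussianMass_mono _ _ Set.inter_subset_left)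
  · exact ne_top_of_le_ne_top hfin (gaussianMass_mono _ _ Set.sdiff_subset)

/-- The amplitudes are nonnegative. [folklore] -/
theorem truncAmp_nonneg (R : ℕ) (s : ι → ZMod R) : 0 ≤ truncAmp Λ e R s := ENNReal.toReal_nonneg

/-- The tails are nonnegative. [folklore] -/
theorem tailAmp_nonneg (R : ℕ) (s : ι → ZMod R) : 0 ≤ tailAmp Λ e R s := ENNReal.toReal_nonneg

/-! ### The transversal of representatives -/

variable [DecidableEq ι]

/-- **The set of representatives `{x_s : s ∈ ℤ_Rⁿ}`.** [cite: Regev2009, Lemma 3.14] -/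
def reprSet (R : ℕ) [NeZero R] : Finset V :=
  Finset.univ.map ⟨reprPt Λ e R, reprPt_injective Λ e R⟩

omit [InnerProductSpace ℝ V] in
/-- Membership in `reprSet`. [folklore] -/
theorem mem_reprSet {R : ℕ} [NeZero R] {x : V} : x ∈ reprSet Λ e R ↔ ∃ s, reprPt Λ e R s = x := by
  simp [reprSet]

omit [InnerProductSpace ℝ V] in
/-- Sums over `reprSet` are sums over `ℤ_Rⁿ`. [folklore] -/
theorem sum_reprSet {R : ℕ} [NeZero R] {β : Type*} [AddCommMonoid β] (f : V → β) :
    ∑ x ∈ reprSet Λ e R, f x = ∑ s : ι → ZMod R, f (reprPt Λ e R s) := by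
  rw [reprSet, Finset.sum_map]
  rfl

/-- **The representatives form a transversal of `Λ/RΛ`** (every lattice point is `x_s + R y` for a
unique `s`: Euclidean division of its coordinates). [cite: Regev2009, Lemma 3.14 (the identification of the register with `L*/R ∩ P(L*)`)] -/
theorem isTransversal_reprSet (R : ℕ) [NeZero R] : IsTransversal Λ (scaledLattice Λ R) (reprSet Λ e R) := by
  refine ⟨fun x hx => ?_, fun t ht => ?_⟩
  · obtain ⟨s, rfl⟩ := (mem_reprSet Λ e).1 hx
    exact reprPt_mem Λ e R s
  · -- existence: `t = latticePt m`, `m = val s + R r`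
    set m : ι → ℤ := e.equivFun ⟨t, ht⟩ with hm
    have htm : t = latticePt Λ e m := by rw [hm, latticePt_equivFun]
    refine ⟨reprPt Λ e R ((euclidEquiv R).symm m).1, ⟨(mem_reprSet Λ e).2 ⟨_, rfl⟩, ?_⟩, ?_⟩
    · rw [htm, latticePt_eq_reprPt_add Λ e R m, add_sub_cancel_left]
      exact (mem_scaledLattice Λ).2 ⟨_, by unfold latticePt; exact Submodule.coe_mem _, rfl⟩
    · -- uniqueness
      rintro x ⟨hx, htx⟩
      obtain ⟨s', rfl⟩ := (mem_reprSet Λ e).1 hx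
      set s := ((euclidEquiv R).symm m).1 with hs
      have h1 : t - reprPt Λ e R s ∈ scaledLattice Λ R := by
        rw [htm, latticePt_eq_reprPt_add Λ e R m, add_sub_cancel_left]
        exact (mem_scaledLattice Λ).2 ⟨_, by unfold latticePt; exact Submodule.coe_mem _, rfl⟩
      -- the difference of the two representatives lies in `RΛ`
      have hdiff : reprPt Λ e R s' - reprPt Λ e R s ∈ scaledLattice Λ R := by
        have : reprPt Λ e R s' - reprPt Λ e R s = (t - reprPt Λ e R s) - (t - reprPt Λ e R s') := by abel
        rw [this]
        exact Submodule.sub_mem _ h1 htx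
      obtain ⟨y, hy, hyeq⟩ := (mem_scaledLattice Λ).1 hdiff
      -- in coordinates: `val s' - val s = R • (coords of y)`
      have hcoord : (fun i => ((s' i).val : ℤ)) - (fun i => ((s i).val : ℤ)) = (R : ℤ) • e.equivFun ⟨y, hy⟩ := by
        apply latticePt_injective Λ e
        have hsub : latticePt Λ e ((fun i => ((s' i).val : ℤ)) - fun i => ((s i).val : ℤ)) =
            reprPt Λ e R s' - reprPt Λ e R s := by
          simp only [reprPt, latticePt, map_sub, Submodule.coe_sub]
        rw [hsub, ← hyeq, show (R : ℤ) • e.equivFun ⟨y, hy⟩ = 0 + (R : ℤ) • e.equivFun ⟨y, hy⟩ by rw [zero_add],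
          latticePt_add_smul, latticePt_equivFun, Int.cast_natCast]
        simp [latticePt]
      congr 1
      funext i
      have hi := congrFun hcoord i
      simp only [Pi.sub_apply, Pi.smul_apply, smul_eq_mul] at hi
      -- cast to `ZMod R`
      have hz : ((((s' i).val : ℤ) - ((s i).val : ℤ) : ℤ) : ZMod R) = (((R : ℤ) * e.equivFun ⟨y, hy⟩ i : ℤ) : ZMod R) := by
        rw [hi]
      push_cast at hz
      rw [ZMod.natCast_zmod_val, ZMod.natCast_zmod_val, ZMod.natCast_self, zero_mul, sub_eq_zero] at hz
      exact hz

/-! ### Claim 3.13 in coordinates -/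

/-- **Regev 2009, Claim 3.13 for the register state**: `∑_s (ϑ₂(s) − ϑ₁(s))² ≤ 2^{-2n} ∑_s ϑ₂(s)²`
over `s ∈ ℤ_Rⁿ`, i.e. `‖ϑ₂ − ϑ₁‖ ≤ 2⁻ⁿ‖ϑ₂‖` for the (unnormalised) coordinate vectors — Claim 3.13
(`RegevQuantumApprox.claim_3_13`) for the pair `RΛ ≤ Λ` and the transversal `{x_s}`.
[cite: Regev2009, Claim 3.13, Lemma 3.14 ("this state is exponentially close to the required state")] -/
theorem claim_3_13_coords [FiniteDimensional ℝ V] [DiscreteTopology Λ] [IsZLattice ℝ Λ] (R : ℕ) [NeZero R] :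
    ∑ s : ι → ZMod R, tailAmp Λ e R s ^ 2 ≤
      (2⁻¹ : ℝ) ^ (2 * finrank ℝ V) * ∑ s : ι → ZMod R, periodicAmp Λ e R s ^ 2 := by
  have h := claim_3_13 (scaledLattice_le Λ R) (isTransversal_reprSet Λ e R)
  rw [sum_reprSet, sum_reprSet] at h
  -- pass to reals
  have hfin : ∀ s : ι → ZMod R, gaussianMass 1 (-reprPt Λ e R s) (scaledLattice Λ R : Set V) ≠ ⊤ := fun s =>
    gaussianMass_lattice_ne_top (scaledLattice Λ R) one_ne_zero _
  have hfin' : ∀ s : ι → ZMod R, gaussianMass 1 (-reprPt Λ e R s)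
      ((scaledLattice Λ R : Set V) \ ball (-reprPt Λ e R s) (Real.sqrt (finrank ℝ V))) ≠ ⊤ := fun s =>
    ne_top_of_le_ne_top (hfin s) (gaussianMass_mono _ _ Set.sdiff_subset)
  have hcB : (2⁻¹ : ℝ≥0∞) ^ (2 * finrank ℝ V) *
      ∑ s : ι → ZMod R, gaussianMass 1 (-reprPt Λ e R s) (scaledLattice Λ R : Set V) ^ 2 ≠ ⊤ :=
    ENNReal.mul_ne_top (ENNReal.pow_ne_top (by simp))
      (ENNReal.sum_ne_top.2 fun s _ => ENNReal.pow_ne_top (hfin s))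
  have hr := ENNReal.toReal_mono hcB h
  rw [ENNReal.toReal_sum (fun s _ => ENNReal.pow_ne_top (hfin' s)), ENNReal.toReal_mul, ENNReal.toReal_pow,
    ENNReal.toReal_inv, ENNReal.toReal_ofNat, ENNReal.toReal_sum (fun s _ => ENNReal.pow_ne_top (hfin s))] at hr
  simp only [ENNReal.toReal_pow] at hr
  simpa only [tailAmp, periodicAmp_eq_toReal_gaussianMass] using hr

end Regev2009

end Literature.Algebra.EuclideanLattices

end
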